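import Summits.ResolutionOfSingularities.ResolutionOfSingularities.Theorems.HilbertSamuelEliminationSigmaMaxModificationsCorridor3WLadderSegmentsTower
import Summits.ResolutionOfSingularities.ResolutionOfSingularities.Theorems.HilbertSamuelEliminationSigmaMaxModificationsCorridor3WLadderStrataScope
import HarnessLib

/-!
# [OURS · L1 W4.2] (H-emp) IN CHAIN LANGUAGE: the localised centre of a stage is empty iff the canonical centre misses the near locus over the base
# (crux `SigmaMaxModifications` stmt-ResolutionOfSingularities-18506; conjunct `SigmaMaxModificationsCorridor3` stmt-…-19249; line `w_ladder`;
# RECOGNITION-CUT (R5) — the bridge from `Seg.HEmp` (U-seg, `…SegmentsTower`) to the label-side vocabulary)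

Stub worker res-L1-w42-stub-1 (gen 3). Helper file `--supports stmt-ResolutionOfSingularities-19249 --as helper`; kernel only, no named fact, no
new definition. At a base `b` whose marked point is ISOLATED IN ITS `ν`-STRATUM, along a chain from a maximal origin (admissible oracle,
`ν ≠ Φ^{(N)}`):

* `Seg.phi_mem_hsStratum` — the tower maps `φ_n : X_{b+n} → X_b` send the `ν`-stratum into the `ν`-stratum (stub-4's
  `StepProjection.image_hsStratum_subset`, iterated);
* `Seg.mem_nearLocus_of_mem_hsStratum_of_specializes` — a point of `X_{b+n}(ν)` whose image GENERIZES `x_b` lies in the near locus over `x_b`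
  (its image is in `U ∩ X_b(ν) = {x_b}`);
* `Seg.locTower_C_eq_empty_iff` — **the localised centre at stage `n` is empty iff the canonical centre `C_{b+n}` misses the near locus
  `φ_n⁻¹(x_b) ∩ X_{b+n}(ν)`**; hence `Seg.hEmp_iff_nearLocus` — **(H-emp) ⟺ «every WAITING step's centre misses the near locus over `x_b`»**,
  the form in which RECOGNITION-LABELS (R5) is to be proved (label discipline, stub-4's vocabulary).

OURS bookkeeping; NOT a statement of the manuscript [Hironaka2017] nor of [CossartJannsenSaito2020]. AI-written; AI review is weaker than
expert review.

References: V. Cossart, U. Jannsen, S. Saito, LNM 2270 (2020), Def. 6.38 (iii), Rem. 6.29 (1), Thm. 3.10, p. 107 [CossartJannsenSaito2020].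
-/

noncomputable section

set_option linter.dupNamespace false -- namespace `…Corridor3.Moving` re-enters `…Corridor3` (module convention of the Moving files)

open CategoryTheory AlgebraicGeometry TopologicalSpace Topology IsLocalRing
open Literature.AlgebraicGeometry.Resolution Literature.RingTheory.HilbertSamuel
open Literature.AlgebraicGeometry.CossartJannsenSaito2020
open Summit.ResolutionOfSingularities.ResolutionOfSingularities.Theorems.CampaignW42
open Summit.ResolutionOfSingularities.ResolutionOfSingularities.Theorems.SigmaMaxModificationsCorridor3.Helpers

namespace Summit.ResolutionOfSingularities.ResolutionOfSingularities.Theorems.SigmaMaxModificationsCorridor3.Moving.Seg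

universe u

variable {R : ∀ S : Scheme.{u}, CentreSeq S → Prop} {N : ℕ} {ν : ℕ → ℕ} {k : Type u} [Field k]
  {c : ℕ → MarkedStage.{u}} (hc : ∀ n, CanonicalNearStep R N ν (c n) (c (n + 1))) (hRa : OracleAdmissible R)
  (hν : ν ≠ iterPSum N Phi) (h0 : Helpers.CycleInv k N ν (c 0))
  {p : ℕ} {X : Scheme.{u}} [IsLocallyNoetherian X] {x : X} (hX : IsMaximalOrigin p N ν X x)
  (hreach : Reaches R N ν (MarkedStage.init X x) (c 0))

include hX hreach in
/-- **`φ_n` maps `X_{b+n}(ν)` into `X_b(ν)`** (H does not increase along permissible blow-ups; `ν` maximal).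
[cite: CossartJannsenSaito2020, Thm. 3.10 (1)] -/
theorem phi_mem_hsStratum (b : ℕ) : ∀ (n : ℕ) (z : (c (b + n)).W), z ∈ Scheme.hsStratum (c (b + n)).W N ν →
    ((upTower hc hRa hν h0 b).phi n).base z ∈ Scheme.hsStratum (c b).W N ν
  | 0, _, hz => hz
  | n + 1, z, hz => by
    obtain ⟨k', _, hcyc⟩ := exists_cycleInv_chain hRa hν hX hreach hc
    rw [BlowupTower.phi_succ_base]
    refine phi_mem_hsStratum b n _ ?_
    exact StepProjection.image_hsStratum_subset hRa hν (hcyc (b + n)) (Helpers.stepProjection_chainProj (shiftStep hc b) n) ⟨z, hz, rfl⟩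

include hX hreach in
/-- A point of `X_{b+n}(ν)` whose image under `φ_n` GENERIZES `x_b` lies in the near locus over `x_b`, when `x_b` is isolated in `X_b(ν)`.
[cite: CossartJannsenSaito2020, Def. 6.38 (iii), Def. 13.3] -/
theorem mem_nearLocus_of_mem_hsStratum_of_specializes (b : ℕ)
    (hU : ∃ U : Set (c b).W, IsOpen U ∧ (c b).pt ∈ U ∧ U ∩ Scheme.hsStratum (c b).W N ν ⊆ {(c b).pt}) (n : ℕ) (z : (c (b + n)).W)
    (hz : z ∈ Scheme.hsStratum (c (b + n)).W N ν) (hsp : ((upTower hc hRa hν h0 b).phi n).base z ⤳ (c b).pt) :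
    z ∈ (upTower hc hRa hν h0 b).nearLocus N (c b).pt n := by
  obtain ⟨U, hUo, hbU, hUiso⟩ := hU
  have hφ : ((upTower hc hRa hν h0 b).phi n).base z = (c b).pt :=
    hUiso ⟨hsp.mem_open hUo hbU, phi_mem_hsStratum hc hRa hν h0 hX hreach b n z hz⟩
  refine ⟨hφ, ?_⟩
  show Scheme.hsFun (c (b + n)).W N z = Scheme.hsFun (c b).W N (c b).pt
  rw [Scheme.mem_hsStratum_iff.mp hz,
    Scheme.mem_hsStratum_iff.mp (pt_mem_hsStratum_of_reaches hX.mem_stratum (reaches_chain hreach hc b))]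

include hX hreach in
/-- **THE LOCALISED CENTRE AT STAGE `n` IS EMPTY IFF THE CANONICAL CENTRE `C_{b+n}` MISSES THE NEAR LOCUS OVER `x_b`** (base isolated in its
stratum). [cite: CossartJannsenSaito2020, Def. 6.38 (iii), p. 107] -/
theorem locTower_C_eq_empty_iff (b : ℕ)
    (hU : ∃ U : Set (c b).W, IsOpen U ∧ (c b).pt ∈ U ∧ U ∩ Scheme.hsStratum (c b).W N ν ⊆ {(c b).pt}) (n : ℕ) :
    (locTower hc hRa hν h0 b).C n = ∅ ↔
      (upTower hc hRa hν h0 b).C n ∩ (upTower hc hRa hν h0 b).nearLocus N (c b).pt n = ∅ := by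
  haveI : IsLocallyNoetherian ((upTower hc hRa hν h0 b).X 0) := (upTower hc hRa hν h0 b).ln 0
  have hrange : Set.range (locι hc hRa hν h0 b n).base = ((upTower hc hRa hν h0 b).phi n).base ⁻¹' {y | y ⤳ (c b).pt} := by
    rw [show Set.range (locι hc hRa hν h0 b n).base = ((upTower hc hRa hν h0 b).phi n).base ⁻¹'
        Set.range (((upTower hc hRa hν h0 b).X 0).fromSpecStalk ((c b).pt : (upTower hc hRa hν h0 b).X 0)).base from
      (upTower hc hRa hν h0 b).range_bcι _ n, Scheme.range_fromSpecStalk]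
  have hCsub : (upTower hc hRa hν h0 b).C n ⊆ Scheme.hsStratum (c (b + n)).W N ν :=
    (Helpers.chainCentre_package (shiftStep hc b) hRa hν (cycleInv_at hc hRa hν h0 b) n).2.1
  constructor
  · intro h
    refine Set.eq_empty_iff_forall_notMem.mpr fun z ⟨hzC, hzN⟩ => ?_
    have hzr : z ∈ Set.range (locι hc hRa hν h0 b n).base := by
      rw [hrange]
      show ((upTower hc hRa hν h0 b).phi n).base z ⤳ (c b).pt
      rw [hzN.1]
    obtain ⟨y, rfl⟩ := hzr
    have : y ∈ (locTower hc hRa hν h0 b).C n := hzC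
    rw [h] at this
    exact this
  · intro h
    refine Set.eq_empty_iff_forall_notMem.mpr fun y hy => ?_
    have hzC : (locι hc hRa hν h0 b n).base y ∈ (upTower hc hRa hν h0 b).C n := hy
    have hsp : ((upTower hc hRa hν h0 b).phi n).base ((locι hc hRa hν h0 b n).base y) ⤳ (c b).pt := by
      have : (locι hc hRa hν h0 b n).base y ∈ Set.range (locι hc hRa hν h0 b n).base := ⟨y, rfl⟩
      rw [hrange] at this
      exact this
    have hzN := mem_nearLocus_of_mem_hsStratum_of_specializes hc hRa hν h0 hX hreach b hU n _ (hCsub hzC) hsp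
    have : (locι hc hRa hν h0 b n).base y ∈ (upTower hc hRa hν h0 b).C n ∩ (upTower hc hRa hν h0 b).nearLocus N (c b).pt n := ⟨hzC, hzN⟩
    rw [h] at this
    exact this

include hX hreach in
/-- **(H-emp) ⟺ «EVERY WAITING STEP'S CENTRE MISSES THE NEAR LOCUS OVER THE BASE»** (base isolated in its stratum) — the chain-language form of
the recognition hypothesis `Seg.HEmp` for RECOGNITION-LABELS (R5). [cite: CossartJannsenSaito2020, Def. 6.38 (iii), Rem. 6.29 (1)] -/
theorem hEmp_iff_nearLocus (b : ℕ)
    (hU : ∃ U : Set (c b).W, IsOpen U ∧ (c b).pt ∈ U ∧ U ∩ Scheme.hsStratum (c b).W N ν ⊆ {(c b).pt}) :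
    HEmp hc hRa hν h0 b ↔ ∀ n, ¬ (c (b + n)).IsBlownUp R N ν →
      (upTower hc hRa hν h0 b).C n ∩ (upTower hc hRa hν h0 b).nearLocus N (c b).pt n = ∅ :=
  forall_congr' fun n => imp_congr_right fun _ => locTower_C_eq_empty_iff hc hRa hν h0 hX hreach b hU n

end Summit.ResolutionOfSingularities.ResolutionOfSingularities.Theorems.SigmaMaxModificationsCorridor3.Moving.Seg

end
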